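import Summits.QuantumFields.BalabanUV.Beta.GAN24.ScalarUnitLatticeTower

/-!
# `BalabanUV.Beta.GAN24.ScalarUnitLatticeTowerInverse` — binder row G-an2-4 ∕ (CONV-C), route R6 «VALUES, NOT DERIVATIVES», PART 111 (road P3 on road P2's `U = 1`
# scalar objects): THE SCALAR UNIT-LATTICE EFFECTIVE-FORM TOWER `k ↦ (S_{L^k})⁻¹ = (a′Q′G′_{L^k}Q′*)⁻¹` ON A CUBIC UNIT TORUS SATISFIES THE ROW's TWO-CLAUSE SHAPE,
# UNCONDITIONALLY — `‖(S_{L^k})⁻¹(y,y′)‖ ≤ C₅e^{−δ₅|y−y′|}` (k-uniform) AND `‖((S_{L^{k+1}})⁻¹ − (S_{L^k})⁻¹)(y,y′)‖ ≤ C₅·(1∕√L)^k·e^{−δ₅|y−y′|}` — «Σ's RATE IS P's RATE»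
# (PART 107) READ ON BAŁABAN's `U = 1` SCALAR PROTOTYPE: the second resolvent identity over leaf-06's `convC_shape_Savg_tower_cubic` (the two clauses for `S_{L^k}`) and
# leaf-03's `SavgInverseUniform.norm_Savg_inv_apply_le` (the n-uniform decay of `S_n⁻¹`) (unit b2b-balaban-gan24-p3, gen 50; v1)

NOT IN PRINT; OUR PROOF (for the ROUTE; [folklore] — the second resolvent identity `S′⁻¹ − S⁻¹ = S⁻¹(S − S′)S′⁻¹`, a triple-product entry bound, the period-free torus sum
`EffectiveKernel.sum_exp_ldist_le` twice; road P2 ∕ the swarm's theorems BY NAME: `ScalarUnitLatticeTower.convC_shape_Savg_tower_cubic` (leaf-06 g36, p-accepted),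
`SavgInverseUniform.norm_Savg_inv_apply_le` ∕ `sigmaS` ∕ `deltaS` (leaf-03 g49), `HardMinimiserOneStepSup.isUnit_det_Savg` (gan24-p2 g29)).  HONEST FRAMING (cell contract,
verbatim): «discharging `BetaPertH` makes Bałaban's UV stability UNCONDITIONAL — a real constructive-QFT result; it is NOT the continuum limit and NOT the Clay problem.»  HONEST
DEPENDENCY (verbatim): «continuum YM on T⁴ ⇐ BetaPertH ∧ nine spine estimates (0/9 proved); BetaPertH ⇐ (D1) ∧ (D4) ∧ CAP+tail; G-an2-4 gates asym, D1 and NE2/3/4.»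

WHY THIS FILE.  `S_n = a′Q′G′_nQ′*` (`HardMinimiserOneStepSup.Savg`) is `a′·P_n` with `P_n = Q′G′_nQ′*` the unit-lattice block propagator of the scalar block-mean tower at `U = 1`
(`G′_n = (−Δ + a′Q′*Q′)⁻¹` the soft resolvent), so `S_n⁻¹ = a′⁻¹·P_n⁻¹ = a′⁻¹·𝒮_n + 1` carries the EFFECTIVE FORM `𝒮_n` of `−Δ` through `Q′` — the scalar prototype of the
`Δ^{(k)} = CᵀΔ^{(k)}C`-type (Σ-block) constituent of (CONV-C) (ROUTES-GAN24 §0 (0.2) v4: «Σ's rate IS Δ's rate one level up … BOOKKEEPING [TO PROVE, S-size]»).  leaf-06's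
`ScalarUnitLatticeTower` typed the two clauses for `S_{L^k}` (the `Q𝒢Q*`-type P-block); leaf-03's `SavgInverseUniform` typed the k-uniform DECAY of `S_n⁻¹`.  THIS FILE types the
RATE clause of `S_n⁻¹` and packages BOTH clauses for the inverse tower — PART 107's abstract transfer «Σ's RATE IS P's RATE» read on the real `U = 1` scalar objects: no new estimate,
the identity shift `1` is k-independent and drops out of the difference.

WHAT THIS FILE PROVES (0 sorry, 0 `def`, nothing cited; cubic unit tori `fun _ : Fin (d+1) ⇒ N₀`, every `a′ > 0`):
* §1 `inv_sub_inv_eq` (the second resolvent identity for complex matrices with unit determinants), `norm_triple_mul_apply_le` (`‖(XYZ)(y,y′)‖ ≤ Σ‖X‖‖Y‖‖Z‖`), `sum_sum_exp_ldist_le`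
  (the period-free double convolution `Σ_{y₁,y₂}e^{−t|y−y₁|}e^{−t|y₁−y₂|}e^{−t|y₂−y′|} ≤ K_{d+1}(t∕2)²·e^{−(t∕2)|y−y′|}`).
* §2 **`norm_Savg_inv_tower_step_le_cubic`** — the RATE clause: `∃ δ > 0 ∀ L ≥ 2 ∃ C > 0 ∀ N₀ k y y′`, `‖((S_{L^{k+1}})⁻¹ − (S_{L^k})⁻¹)(y,y′)‖ ≤ C·(1∕√L)^k·e^{−δ·|y−y′|_{T,∞}}`.
* §3 **`convC_shape_Savg_inv_tower_cubic`** — BOTH CLAUSES for `k ↦ (S_{L^k})⁻¹` with one pair `(C₅, δ₅)`: `δ₅ = min(δ_S, δ₄)∕2` (a function of `(d, a′)`), `C₅ = max(σ_S, σ_S²·C₄·K_{d+1}(δ₅)²)`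
  (a function of `(d, a′, L)`), chosen BEFORE `N₀`, `k`.
HONEST: [folklore] composition BY NAME; scalar (0-form) `U = 1` PROTOTYPE on CUBIC unit tori (the torus FIXED along the tower), constants ∕ rates EXISTENTIAL in size (inherited);
`θ = L^{−1∕2}` is leaf-06's typing convenience (any `θ > L⁻¹`); the carrier is the finite torus with complex entries and `‖·‖` — the SHAPE of `DirichletExhaustion.ConvC`, not an
instance of that predicate; NOT (CONV-C) as typed (Bałaban's constituents at general `U` with their inputs discharged), NEVER «G-an2-4 closed», NOT NE2 ∕ NE3, NOT D1, NOT `BetaPertH`,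
NOT continuum, NOT Clay.  SUPPLIER work on route C-R6° (rank 2, REDUCTION) over road P2's objects; no consumer of record.  Records: `HOME/b2b-balaban-gan24-p3/gen50/README.md`.
-/

noncomputable section

open scoped BigOperators ComplexConjugate Matrix
open Finset

namespace Summit.QuantumFields.BalabanUV.Beta.GAN24.ScalarUnitLatticeTowerInverse

open Literature.MathematicalPhysics.QuantumFieldTheory.Balaban1983to89
open B5Prop11Plancherel (Tor fine)
open B6LowerBound2153Torus (rep)
open B4TorusKernel.MultiPeriod (torusSupNorm)
open B4Sect5Proof (latticeConst latticeConst_nonneg)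
open Beta.TorusG0Decay (ldist ldist_self ldist_symm ldist_triangle)
open Beta.EffectiveKernel (sum_exp_ldist_le)
open Summit.QuantumFields.BalabanUV.Beta.GAN24.HardMinimiserOneStepSup (Savg isUnit_det_Savg)
open Summit.QuantumFields.BalabanUV.Beta.GAN24.SavgInverseUniform (sigmaS deltaS sigmaS_pos deltaS_pos ldist_nonneg ldist_eq_torusSupNorm norm_Savg_inv_apply_le)
open Summit.QuantumFields.BalabanUV.Beta.GAN24.ScalarUnitLatticeTower (convC_shape_Savg_tower_cubic)

variable (d : ℕ)

/-! ## §1 Three elementary tools -/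

variable {d} in
/-- **the second resolvent identity** for complex matrices with unit determinants: `A⁻¹ − B⁻¹ = A⁻¹(B − A)B⁻¹`. [folklore] -/
theorem inv_sub_inv_eq {ι : Type*} [Fintype ι] [DecidableEq ι] {A B : Matrix ι ι ℂ} (hA : IsUnit A.det) (hB : IsUnit B.det) :
    A⁻¹ - B⁻¹ = A⁻¹ * (B - A) * B⁻¹ := by
  rw [Matrix.mul_sub, Matrix.sub_mul, Matrix.mul_assoc A⁻¹ B B⁻¹, Matrix.mul_nonsing_inv B hB, Matrix.mul_one, Matrix.nonsing_inv_mul A hA,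
    Matrix.one_mul]

variable {d} in
/-- **entry bound of a triple product**: `‖(XYZ)(y,y′)‖ ≤ Σ_{y₁,y₂} ‖X(y,y₁)‖·‖Y(y₁,y₂)‖·‖Z(y₂,y′)‖`. [folklore] -/
theorem norm_triple_mul_apply_le {ι : Type*} [Fintype ι] (X Y Z : Matrix ι ι ℂ) (y y' : ι) :
    ‖(X * Y * Z) y y'‖ ≤ ∑ y₁, ∑ y₂, ‖X y y₁‖ * ‖Y y₁ y₂‖ * ‖Z y₂ y'‖ := by
  rw [Matrix.mul_apply]
  refine (norm_sum_le _ _).trans ?_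
  rw [Finset.sum_comm]
  refine Finset.sum_le_sum fun y₂ _ => ?_
  rw [norm_mul, Matrix.mul_apply]
  calc ‖∑ y₁, X y y₁ * Y y₁ y₂‖ * ‖Z y₂ y'‖ ≤ (∑ y₁, ‖X y y₁ * Y y₁ y₂‖) * ‖Z y₂ y'‖ :=
        mul_le_mul_of_nonneg_right (norm_sum_le _ _) (norm_nonneg _)
    _ = ∑ y₁, ‖X y y₁‖ * ‖Y y₁ y₂‖ * ‖Z y₂ y'‖ := by
        rw [Finset.sum_mul]; exact Finset.sum_congr rfl fun y₁ _ => by rw [norm_mul]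

variable {d} in
/-- **the period-free double convolution on the unit torus**: `Σ_{y₁,y₂} e^{−t·d(y,y₁)}e^{−t·d(y₁,y₂)}e^{−t·d(y₂,y′)} ≤ K_{d+1}(t∕2)²·e^{−(t∕2)·d(y,y′)}`, `d = ldist`
(triangle inequality twice; `EffectiveKernel.sum_exp_ldist_le`). [folklore] -/
theorem sum_sum_exp_ldist_le (M : Fin (d + 1) → ℕ) [∀ μ, NeZero (M μ)] {t : ℝ} (ht : 0 < t) (y y' : Tor M) :
    ∑ y₁, ∑ y₂, Real.exp (-(t * ldist M y y₁)) * Real.exp (-(t * ldist M y₁ y₂)) * Real.exp (-(t * ldist M y₂ y')) ≤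
      latticeConst (d + 1) (t / 2) ^ 2 * Real.exp (-(t / 2 * ldist M y y')) := by
  have hpt : ∀ y₁ y₂, Real.exp (-(t * ldist M y y₁)) * Real.exp (-(t * ldist M y₁ y₂)) * Real.exp (-(t * ldist M y₂ y')) ≤
      Real.exp (-(t / 2 * ldist M y y')) * (Real.exp (-(t / 2 * ldist M y y₁)) * Real.exp (-(t / 2 * ldist M y' y₂))) := fun y₁ y₂ => by
    rw [← Real.exp_add, ← Real.exp_add, ← Real.exp_add, ← Real.exp_add]
    apply Real.exp_le_exp.mpr
    have h1 := ldist_triangle M y y₁ y'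
    have h2 := ldist_triangle M y₁ y₂ y'
    have h3 := ldist_nonneg M y y₁
    have h4 := ldist_nonneg M y₁ y₂
    have h5 := ldist_nonneg M y₂ y'
    rw [ldist_symm M y' y₂]
    nlinarith
  have hK : 0 ≤ latticeConst (d + 1) (t / 2) := latticeConst_nonneg _ (by linarith)
  calc ∑ y₁, ∑ y₂, Real.exp (-(t * ldist M y y₁)) * Real.exp (-(t * ldist M y₁ y₂)) * Real.exp (-(t * ldist M y₂ y'))
      ≤ ∑ y₁, ∑ y₂, Real.exp (-(t / 2 * ldist M y y')) * (Real.exp (-(t / 2 * ldist M y y₁)) * Real.exp (-(t / 2 * ldist M y' y₂))) :=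
        Finset.sum_le_sum fun y₁ _ => Finset.sum_le_sum fun y₂ _ => hpt y₁ y₂
    _ = Real.exp (-(t / 2 * ldist M y y')) * ((∑ y₁, Real.exp (-(t / 2 * ldist M y y₁))) * ∑ y₂, Real.exp (-(t / 2 * ldist M y' y₂))) := by
        rw [Finset.sum_mul_sum, Finset.mul_sum]
        refine Finset.sum_congr rfl fun y₁ _ => ?_
        rw [Finset.mul_sum]
    _ ≤ Real.exp (-(t / 2 * ldist M y y')) * (latticeConst (d + 1) (t / 2) * latticeConst (d + 1) (t / 2)) := by
        apply mul_le_mul_of_nonneg_left _ (Real.exp_pos _).le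
        exact mul_le_mul (sum_exp_ldist_le M y (by linarith)) (sum_exp_ldist_le M y' (by linarith))
          (Finset.sum_nonneg fun _ _ => (Real.exp_pos _).le) hK
    _ = latticeConst (d + 1) (t / 2) ^ 2 * Real.exp (-(t / 2 * ldist M y y')) := by ring

/-! ## §2 The rate clause of the inverse tower -/

/-- **`norm_Savg_inv_tower_step_le_cubic` — THE ONE-STEP RATE OF THE SCALAR UNIT-LATTICE EFFECTIVE FORM, ENTRYWISE WITH DECAY, UNCONDITIONAL** [our proof]: `∃ δ > 0`
(function of `d, a′`), `∀ L ≥ 2, ∃ C > 0` (function of `d, a′, L`), `∀ N₀ ≥ 1, ∀ k y y′`: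
`‖((S_{L^{k+1}})⁻¹ − (S_{L^k})⁻¹)(y,y′)‖ ≤ C·(1∕√L)^k·e^{−δ·|y − y′|_{T,∞}}` — `S′⁻¹ − S⁻¹ = S⁻¹(S − S′)S′⁻¹`, the two clauses of leaf-06's `convC_shape_Savg_tower_cubic` for the middle
factor at the common rate, leaf-03's k-uniform decay of `S_n⁻¹` for the outer factors, the double convolution. -/
theorem norm_Savg_inv_tower_step_le_cubic {a' : ℝ} (ha' : 0 < a') :
    ∃ δ : ℝ, 0 < δ ∧ ∀ (L : ℕ) [NeZero L], 2 ≤ L → ∃ C : ℝ, 0 < C ∧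
      ∀ (N₀ : ℕ) [NeZero N₀] (k : ℕ) (y y' : Tor (fun _ : Fin (d + 1) => N₀)),
        ‖((Savg (L ^ (k + 1)) (fun _ : Fin (d + 1) => N₀) a')⁻¹ - (Savg (L ^ k) (fun _ : Fin (d + 1) => N₀) a')⁻¹) y y'‖
            ≤ C * ((Real.sqrt L)⁻¹) ^ k * Real.exp (-(δ * torusSupNorm (fun _ : Fin (d + 1) => N₀)
                (rep (fun _ : Fin (d + 1) => N₀) y - rep (fun _ : Fin (d + 1) => N₀) y'))) := by
  obtain ⟨δ₄, hδ₄, hstep⟩ := convC_shape_Savg_tower_cubic d ha'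
  set t : ℝ := min (deltaS d a') δ₄ with ht
  have htpos : 0 < t := lt_min (deltaS_pos d ha') hδ₄
  have htS : t ≤ deltaS d a' := min_le_left _ _
  have ht4 : t ≤ δ₄ := min_le_right _ _
  refine ⟨t / 2, by linarith, fun L _ hL2 => ?_⟩
  obtain ⟨C₄, hC₄, h⟩ := hstep L hL2
  have hσ := sigmaS_pos d ha'
  have hK : 0 ≤ latticeConst (d + 1) (t / 2) := latticeConst_nonneg _ (by linarith)
  refine ⟨sigmaS d a' ^ 2 * C₄ * latticeConst (d + 1) (t / 2) ^ 2 + 1, by positivity, fun N₀ _ k y y' => ?_⟩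
  have hθ0 : 0 ≤ (Real.sqrt L)⁻¹ := by positivity
  -- the three factors, all at the common rate `t`
  have hweak : ∀ {r : ℝ} (z z' : Tor (fun _ : Fin (d + 1) => N₀)), t ≤ r →
      Real.exp (-(r * ldist (fun _ : Fin (d + 1) => N₀) z z')) ≤ Real.exp (-(t * ldist (fun _ : Fin (d + 1) => N₀) z z')) :=
    fun z z' hr => Real.exp_le_exp.mpr (by have := ldist_nonneg (fun _ : Fin (d + 1) => N₀) z z'; nlinarith)
  have hinv : ∀ (n : ℕ) [NeZero n] (z z' : Tor (fun _ : Fin (d + 1) => N₀)),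
      ‖(Savg n (fun _ : Fin (d + 1) => N₀) a')⁻¹ z z'‖ ≤ sigmaS d a' * Real.exp (-(t * ldist (fun _ : Fin (d + 1) => N₀) z z')) :=
    fun n _ z z' => (norm_Savg_inv_apply_le n (fun _ : Fin (d + 1) => N₀) ha' z z').trans (mul_le_mul_of_nonneg_left (hweak z z' htS) hσ.le)
  have hmid : ∀ z z' : Tor (fun _ : Fin (d + 1) => N₀),
      ‖(Savg (L ^ k) (fun _ : Fin (d + 1) => N₀) a' - Savg (L ^ (k + 1)) (fun _ : Fin (d + 1) => N₀) a') z z'‖ ≤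
        C₄ * ((Real.sqrt L)⁻¹) ^ k * Real.exp (-(t * ldist (fun _ : Fin (d + 1) => N₀) z z')) := fun z z' => by
    have h2 := (h N₀ k z z').2
    rw [← ldist_eq_torusSupNorm (fun _ : Fin (d + 1) => N₀) z z'] at h2
    rw [← neg_sub, Matrix.neg_apply, norm_neg]
    exact h2.trans (mul_le_mul_of_nonneg_left (hweak z z' ht4) (by positivity))
  -- the second resolvent identity and the triple product
  have hid : (Savg (L ^ (k + 1)) (fun _ : Fin (d + 1) => N₀) a')⁻¹ - (Savg (L ^ k) (fun _ : Fin (d + 1) => N₀) a')⁻¹ =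
      (Savg (L ^ (k + 1)) (fun _ : Fin (d + 1) => N₀) a')⁻¹ *
        (Savg (L ^ k) (fun _ : Fin (d + 1) => N₀) a' - Savg (L ^ (k + 1)) (fun _ : Fin (d + 1) => N₀) a') *
        (Savg (L ^ k) (fun _ : Fin (d + 1) => N₀) a')⁻¹ :=
    inv_sub_inv_eq (isUnit_det_Savg (L ^ (k + 1)) (fun _ : Fin (d + 1) => N₀) ha') (isUnit_det_Savg (L ^ k) (fun _ : Fin (d + 1) => N₀) ha')
  rw [hid]
  calc ‖((Savg (L ^ (k + 1)) (fun _ : Fin (d + 1) => N₀) a')⁻¹ *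
        (Savg (L ^ k) (fun _ : Fin (d + 1) => N₀) a' - Savg (L ^ (k + 1)) (fun _ : Fin (d + 1) => N₀) a') *
        (Savg (L ^ k) (fun _ : Fin (d + 1) => N₀) a')⁻¹) y y'‖
      ≤ ∑ y₁, ∑ y₂, ‖(Savg (L ^ (k + 1)) (fun _ : Fin (d + 1) => N₀) a')⁻¹ y y₁‖ *
          ‖(Savg (L ^ k) (fun _ : Fin (d + 1) => N₀) a' - Savg (L ^ (k + 1)) (fun _ : Fin (d + 1) => N₀) a') y₁ y₂‖ *
          ‖(Savg (L ^ k) (fun _ : Fin (d + 1) => N₀) a')⁻¹ y₂ y'‖ := norm_triple_mul_apply_le _ _ _ y y'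
    _ ≤ ∑ y₁, ∑ y₂, (sigmaS d a' * Real.exp (-(t * ldist (fun _ : Fin (d + 1) => N₀) y y₁))) *
          (C₄ * ((Real.sqrt L)⁻¹) ^ k * Real.exp (-(t * ldist (fun _ : Fin (d + 1) => N₀) y₁ y₂))) *
          (sigmaS d a' * Real.exp (-(t * ldist (fun _ : Fin (d + 1) => N₀) y₂ y'))) :=
        Finset.sum_le_sum fun y₁ _ => Finset.sum_le_sum fun y₂ _ =>
          mul_le_mul (mul_le_mul (hinv (L ^ (k + 1)) y y₁) (hmid y₁ y₂) (norm_nonneg _) (by positivity)) (hinv (L ^ k) y₂ y') (norm_nonneg _)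
            (by positivity)
    _ = sigmaS d a' ^ 2 * C₄ * ((Real.sqrt L)⁻¹) ^ k *
          ∑ y₁, ∑ y₂, Real.exp (-(t * ldist (fun _ : Fin (d + 1) => N₀) y y₁)) * Real.exp (-(t * ldist (fun _ : Fin (d + 1) => N₀) y₁ y₂)) *
            Real.exp (-(t * ldist (fun _ : Fin (d + 1) => N₀) y₂ y')) := by
        rw [Finset.mul_sum]
        refine Finset.sum_congr rfl fun y₁ _ => ?_
        rw [Finset.mul_sum]
        exact Finset.sum_congr rfl fun y₂ _ => by ring
    _ ≤ sigmaS d a' ^ 2 * C₄ * ((Real.sqrt L)⁻¹) ^ k *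
          (latticeConst (d + 1) (t / 2) ^ 2 * Real.exp (-(t / 2 * ldist (fun _ : Fin (d + 1) => N₀) y y'))) :=
        mul_le_mul_of_nonneg_left (sum_sum_exp_ldist_le (fun _ : Fin (d + 1) => N₀) htpos y y') (by positivity)
    _ ≤ (sigmaS d a' ^ 2 * C₄ * latticeConst (d + 1) (t / 2) ^ 2 + 1) * ((Real.sqrt L)⁻¹) ^ k *
          Real.exp (-(t / 2 * ldist (fun _ : Fin (d + 1) => N₀) y y')) := by
        have hE : 0 ≤ ((Real.sqrt L)⁻¹) ^ k * Real.exp (-(t / 2 * ldist (fun _ : Fin (d + 1) => N₀) y y')) := by positivity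
        nlinarith
    _ = (sigmaS d a' ^ 2 * C₄ * latticeConst (d + 1) (t / 2) ^ 2 + 1) * ((Real.sqrt L)⁻¹) ^ k *
          Real.exp (-(t / 2 * torusSupNorm (fun _ : Fin (d + 1) => N₀)
            (rep (fun _ : Fin (d + 1) => N₀) y - rep (fun _ : Fin (d + 1) => N₀) y'))) := by
        rw [ldist_eq_torusSupNorm (fun _ : Fin (d + 1) => N₀) y y']

/-! ## §3 Both clauses for the inverse tower -/

/-- **`convC_shape_Savg_inv_tower_cubic` — THE SCALAR UNIT-LATTICE EFFECTIVE-FORM TOWER SATISFIES THE ROW's TWO-CLAUSE SHAPE, UNCONDITIONALLY** [our proof]: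
`∃ δ₅ > 0` (function of `d, a′`), `∀ L ≥ 2, ∃ C₅ > 0` (function of `d, a′, L`), `∀ N₀ ≥ 1, ∀ k y y′`:
`‖(S_{L^k})⁻¹(y,y′)‖ ≤ C₅·e^{−δ₅|y−y′|_{T,∞}}` (clause 1 = leaf-03's `norm_Savg_inv_apply_le`, every `n`, every torus) ∧
`‖((S_{L^{k+1}})⁻¹ − (S_{L^k})⁻¹)(y,y′)‖ ≤ C₅·(1∕√L)^k·e^{−δ₅|y−y′|_{T,∞}}` (clause 2 = §2) — with `S_n⁻¹ = a′⁻¹·𝒮_n + 1`, the two clauses of (CONV-C)'s SHAPE for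
the effective form `𝒮_n` of the scalar block-mean tower at `U = 1` (the identity is diagonal and k-independent). -/
theorem convC_shape_Savg_inv_tower_cubic {a' : ℝ} (ha' : 0 < a') :
    ∃ δ₅ : ℝ, 0 < δ₅ ∧ ∀ (L : ℕ) [NeZero L], 2 ≤ L → ∃ C₅ : ℝ, 0 < C₅ ∧
      ∀ (N₀ : ℕ) [NeZero N₀] (k : ℕ) (y y' : Tor (fun _ : Fin (d + 1) => N₀)),
        ‖(Savg (L ^ k) (fun _ : Fin (d + 1) => N₀) a')⁻¹ y y'‖
            ≤ C₅ * Real.exp (-(δ₅ * torusSupNorm (fun _ : Fin (d + 1) => N₀)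
                (rep (fun _ : Fin (d + 1) => N₀) y - rep (fun _ : Fin (d + 1) => N₀) y'))) ∧
        ‖((Savg (L ^ (k + 1)) (fun _ : Fin (d + 1) => N₀) a')⁻¹ - (Savg (L ^ k) (fun _ : Fin (d + 1) => N₀) a')⁻¹) y y'‖
            ≤ C₅ * ((Real.sqrt L)⁻¹) ^ k * Real.exp (-(δ₅ * torusSupNorm (fun _ : Fin (d + 1) => N₀)
                (rep (fun _ : Fin (d + 1) => N₀) y - rep (fun _ : Fin (d + 1) => N₀) y'))) := by
  obtain ⟨δ, hδ, hstep⟩ := norm_Savg_inv_tower_step_le_cubic d ha'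
  set δ₅ : ℝ := min δ (deltaS d a') with hδ₅
  have hδ₅pos : 0 < δ₅ := lt_min hδ (deltaS_pos d ha')
  refine ⟨δ₅, hδ₅pos, fun L _ hL2 => ?_⟩
  obtain ⟨C, hC, h⟩ := hstep L hL2
  have hσ := sigmaS_pos d ha'
  refine ⟨max C (sigmaS d a'), lt_max_of_lt_left hC, fun N₀ _ k y y' => ⟨?_, ?_⟩⟩
  · -- clause 1: leaf-03's k-uniform decay, at the weaker rate `δ₅ ≤ δ_S`
    have h1 := norm_Savg_inv_apply_le (L ^ k) (fun _ : Fin (d + 1) => N₀) ha' y y'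
    rw [ldist_eq_torusSupNorm (fun _ : Fin (d + 1) => N₀) y y'] at h1
    refine h1.trans (mul_le_mul (le_max_right _ _) (Real.exp_le_exp.mpr ?_) (Real.exp_pos _).le (le_trans hσ.le (le_max_right _ _)))
    have h0 : 0 ≤ torusSupNorm (fun _ : Fin (d + 1) => N₀) (rep (fun _ : Fin (d + 1) => N₀) y - rep (fun _ : Fin (d + 1) => N₀) y') := by
      rw [← ldist_eq_torusSupNorm (fun _ : Fin (d + 1) => N₀) y y']; exact ldist_nonneg (fun _ : Fin (d + 1) => N₀) y y'
    nlinarith [min_le_right δ (deltaS d a')]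
  · -- clause 2: §2 at the weaker rate `δ₅ ≤ δ`
    have h2 := h N₀ k y y'
    have h0 : 0 ≤ torusSupNorm (fun _ : Fin (d + 1) => N₀) (rep (fun _ : Fin (d + 1) => N₀) y - rep (fun _ : Fin (d + 1) => N₀) y') := by
      rw [← ldist_eq_torusSupNorm (fun _ : Fin (d + 1) => N₀) y y']; exact ldist_nonneg (fun _ : Fin (d + 1) => N₀) y y'
    refine h2.trans (mul_le_mul (mul_le_mul_of_nonneg_right (le_max_left _ _) (by positivity)) (Real.exp_le_exp.mpr ?_) (Real.exp_pos _).le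
      (by positivity))
    nlinarith [min_le_left δ (deltaS d a')]

end Summit.QuantumFields.BalabanUV.Beta.GAN24.ScalarUnitLatticeTowerInverse

end
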